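import Summits.CriticalPhenomena.PercolationContinuityZ3.Theorems.PercNearOneGluingNoHeavyLowerTailCILPeeling
import Summits.CriticalPhenomena.PercolationContinuityZ3.Theorems.PercNearOneGluingNoHeavyLowerTailCILSubStarReference
import HarnessLib

/-!
# `NoHeavyLowerTail` (stmt-CriticalPhenomena-4575) — the glued pair of relay-neighboured Steiner vertices with a ONE-SIDED
# reference, and CIL for an observer with two light Steiner neighbours

Support file (prover `prim-hp-3`, hull-port line; `--supports stmt-CriticalPhenomena-4575`).  No definitions, no named
facts, no sorries.

Notation: `μ_w = prodBernoulli w` on `Fin n`, relays `A`, level `j`, `π(x) = {z ∈ A : x ↔ z}`, `π(S) = ⋃_{x ∈ S} π(x)`,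
`I_w(x) = μ_w{|π(x)| ≤ j}`, `bad_w(o) = μ_w{1 ≤ |π(o)| ≤ j}`, `w ∖ v = fun e => if e ∈ {e | v ∉ e} then w e else 0` (the graph
`G − v`), and the set-champion-stability inequality `CS_w(S, c) : μ_w(c ↮ S, 1 ≤ |π(S)| ≤ j) ≤ μ_w(c ↮ S, |π(c)| ≤ j)` (spelled
as in `Literature.….observerSet_le_of_lonelier` and `Theorems.setCS_of_peeling`).

The lead's MINIMAL OPEN CORE of the hull-port residual (LEAD-GEN1.md, crux evidence) is `CS_H({u₁,u₂}, q)` for two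
relay-neighboured, non-adjacent non-relays `u₁, u₂` (it is the star `{u₁,u₂}` in the star transfer `Theorems.cil_of_starStability`
at an observer with two light Steiner neighbours); conjecturally it holds whenever `q` dominates the ports of `u₁` and `u₂` in `H`
itself (own census: 0 / 4 700).  This file proves it for the ONE-SIDED reference `H − u₂`:

* `HullPort.setCS_of_peeling_dominated` — peeling a RELAY-NEIGHBOURED member `v` of an observer set `S` is free as soon as the
  witness `c` dominates the ports of `v` in `w ∖ v`: `CS_{w∖v}(S ∖ v, c) ⇒ CS_w(S, c)` (`Theorems.setCS_of_peeling` + the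
  lonely-cluster exchange `observerSet_le_of_lonelier` on every nonempty star, which contains a dominated relay).
* `HullPort.setCS_pair_of_oneSided` — **`CS_w({u₁,u₂}, q)` whenever `q ∈ A` dominates the ports of `u₂` in `w ∖ u₂` and is a
  valid witness for `u₁` in `w ∖ u₂`** (the latter e.g. by `HullPort.cil_of_portDomination_scaled`: `q` dominates the ports of
  `u₁` in any `u₁`-scaled version of `w ∖ u₂`).
* `HullPort.setCS_avoid_of_off` — transfer of `CS_{w∖o}(B, b)` to the `H`-reachability form under `μ_w` used by the star
  transfer (`Theorems.cil_of_starStability`, `HullPort.cil_depthTwo_of_split`).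
The observer-level corollary (a depth-two observer with two non-relay neighbours; it plugs `setCS_pair_of_oneSided` into
`HullPort.cil_depthTwo_of_split` of prover `prim-hp-1`) is in the companion file `…CILGluedPairDepthTwo.lean`.  Exact census
(lab/menu2.py, n ≤ 9): some relay satisfies the resulting menu of hypotheses in 1 563 of 1 566 instances with two light
relay-neighboured Steiner neighbours (the other 3 need the two-sided reference `H`).
-/

noncomputable section

namespace Summit.CriticalPhenomena.PercolationContinuityZ3.Theorems

open MeasureTheory Set Literature.Probability.LatticeModels Literature.Probability.Percolation
open scoped Classical BigOperators

variable {n : ℕ}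

namespace HullPort

/-- **Peeling a relay-neighboured member whose ports are dominated.**  Let `v ∈ S` be a non-relay all of whose positive-weight
neighbours are relays `y` with `I_{w∖v}(y) ≤ I_{w∖v}(c)`, and `c ∉ S`.  If `CS_{w∖v}(S ∖ v, c)` holds (when `S ∖ v ≠ ∅`), then
`CS_w(S, c)`. [cite: VandenbergHaggstromKahn2005, Thm. 1.5 (p. 7) — corollary] -/
theorem setCS_of_peeling_dominated (w : Sym2 (Fin n) → unitInterval) (A S : Finset (Fin n)) (v c : Fin n) (j : ℕ)
    (hvS : v ∈ S) (hvA : v ∉ A) (hcS : c ∉ S)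
    (hdom : ∀ y, y ≠ v → w s(v, y) ≠ 0 → y ∈ A ∧
      (prodBernoulli fun e => if e ∈ {e : Sym2 (Fin n) | v ∉ e} then w e else 0).real
          {ω : BondConfig (Fin n) | (A.filter fun z => ω ∈ openConn y z).card ≤ j} ≤
        (prodBernoulli fun e => if e ∈ {e : Sym2 (Fin n) | v ∉ e} then w e else 0).real
          {ω : BondConfig (Fin n) | (A.filter fun z => ω ∈ openConn c z).card ≤ j})
    (hrest : (S.erase v).Nonempty →
      (prodBernoulli fun e => if e ∈ {e : Sym2 (Fin n) | v ∉ e} then w e else 0).real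
          {ω : BondConfig (Fin n) | (∀ x ∈ S.erase v, ω ∉ openConn c x) ∧
            1 ≤ (A.filter fun z => ∃ x ∈ S.erase v, ω ∈ openConn x z).card ∧
            (A.filter fun z => ∃ x ∈ S.erase v, ω ∈ openConn x z).card ≤ j} ≤
        (prodBernoulli fun e => if e ∈ {e : Sym2 (Fin n) | v ∉ e} then w e else 0).real
          {ω : BondConfig (Fin n) | (∀ x ∈ S.erase v, ω ∉ openConn c x) ∧
            (A.filter fun z => ω ∈ openConn c z).card ≤ j}) :
    (prodBernoulli w).real {ω : BondConfig (Fin n) | (∀ x ∈ S, ω ∉ openConn c x) ∧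
        1 ≤ (A.filter fun z => ∃ x ∈ S, ω ∈ openConn x z).card ∧
        (A.filter fun z => ∃ x ∈ S, ω ∈ openConn x z).card ≤ j} ≤
      (prodBernoulli w).real {ω : BondConfig (Fin n) | (∀ x ∈ S, ω ∉ openConn c x) ∧
        (A.filter fun z => ω ∈ openConn c z).card ≤ j} := by
  refine setCS_of_peeling w A S v c j hvS hvA hcS fun B hB hcB hne => ?_
  rcases B.eq_empty_or_nonempty with rfl | ⟨y, hy⟩
  · rw [Finset.union_empty] at hne ⊢
    exact hrest hne
  · obtain ⟨hyA, hle⟩ := hdom y (hB y hy).1 (hB y hy).2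
    convert observerSet_le_of_lonelier _ A (S.erase v ∪ B) y c (Finset.mem_union_right _ hy) j hle using 12

/-- **The glued pair with a one-sided reference.**  Let `u₁ ≠ u₂` be non-relays and `q ∈ A`.  Suppose every positive-weight
neighbour `y` of `u₂` is a relay with `I_{w∖u₂}(y) ≤ I_{w∖u₂}(q)` (the ports of `u₂` are dominated in `w ∖ u₂`; in particular
`w s(u₁,u₂) = 0`), and `q` is a valid CIL witness for `u₁` in `w ∖ u₂`: `bad_{w∖u₂}(u₁) ≤ I_{w∖u₂}(q)`.  Then
`CS_w({u₁,u₂}, q)`: `μ_w(q ↮ u₁, q ↮ u₂, 1 ≤ |π(u₁) ∪ π(u₂)| ≤ j) ≤ μ_w(q ↮ u₁, q ↮ u₂, |π(q)| ≤ j)`.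
(Peel `u₂`; the empty star leaves `CS_{w∖u₂}({u₁}, q)` (`SubStar.setCS_singleton_of_cil`, prover `prim-hp-2`), every other star contains a dominated relay.)
[cite: VandenbergHaggstromKahn2005, Thm. 1.5 (p. 7) — corollary] -/
theorem setCS_pair_of_oneSided (w : Sym2 (Fin n) → unitInterval) (A : Finset (Fin n)) (u₁ u₂ q : Fin n) (j : ℕ)
    (h12 : u₁ ≠ u₂) (hu₁A : u₁ ∉ A) (hu₂A : u₂ ∉ A) (hqA : q ∈ A)
    (hdom : ∀ y, y ≠ u₂ → w s(u₂, y) ≠ 0 → y ∈ A ∧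
      (prodBernoulli fun e => if e ∈ {e : Sym2 (Fin n) | u₂ ∉ e} then w e else 0).real
          {ω : BondConfig (Fin n) | (A.filter fun z => ω ∈ openConn y z).card ≤ j} ≤
        (prodBernoulli fun e => if e ∈ {e : Sym2 (Fin n) | u₂ ∉ e} then w e else 0).real
          {ω : BondConfig (Fin n) | (A.filter fun z => ω ∈ openConn q z).card ≤ j})
    (hvalid : (prodBernoulli fun e => if e ∈ {e : Sym2 (Fin n) | u₂ ∉ e} then w e else 0).real
        {ω : BondConfig (Fin n) | 1 ≤ (A.filter fun x => ω ∈ openConn u₁ x).card ∧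
          (A.filter fun x => ω ∈ openConn u₁ x).card ≤ j} ≤
      (prodBernoulli fun e => if e ∈ {e : Sym2 (Fin n) | u₂ ∉ e} then w e else 0).real
        {ω : BondConfig (Fin n) | (A.filter fun x => ω ∈ openConn q x).card ≤ j}) :
    (prodBernoulli w).real {ω : BondConfig (Fin n) | (∀ x ∈ ({u₁, u₂} : Finset (Fin n)), ω ∉ openConn q x) ∧
        1 ≤ (A.filter fun z => ∃ x ∈ ({u₁, u₂} : Finset (Fin n)), ω ∈ openConn x z).card ∧
        (A.filter fun z => ∃ x ∈ ({u₁, u₂} : Finset (Fin n)), ω ∈ openConn x z).card ≤ j} ≤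
      (prodBernoulli w).real {ω : BondConfig (Fin n) | (∀ x ∈ ({u₁, u₂} : Finset (Fin n)), ω ∉ openConn q x) ∧
        (A.filter fun z => ω ∈ openConn q z).card ≤ j} := by
  have hqS : q ∉ ({u₁, u₂} : Finset (Fin n)) := by
    simp only [Finset.mem_insert, Finset.mem_singleton, not_or]
    exact ⟨fun h => hu₁A (h ▸ hqA), fun h => hu₂A (h ▸ hqA)⟩
  have herase : ({u₁, u₂} : Finset (Fin n)).erase u₂ = {u₁} := by
    ext x
    simp only [Finset.mem_erase, Finset.mem_insert, Finset.mem_singleton]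
    constructor
    · rintro ⟨hne, h | h⟩
      · exact h
      · exact absurd h hne
    · intro h
      exact ⟨h ▸ h12, Or.inl h⟩
  refine setCS_of_peeling_dominated w A {u₁, u₂} u₂ q j (by simp) hu₂A hqS hdom ?_
  intro _
  rw [herase]
  exact SubStar.setCS_singleton_of_cil _ A u₁ q j hqA hvalid


/-! ### Depth-two observers with two non-relay neighbours -/

/-- **Transfer of set-champion stability from `w ∖ o` to `H`-reachability under `μ_w`.**  The plain inequality
`CS_{w∖o}(B, b)` (weights with the pairs at `o` switched off) is the same statement as `CS_H(B, b)` written with open paths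
avoiding `o` under `μ_w` (`CutObserver.measureReal_preimage_avoid`). [folklore] -/
theorem setCS_avoid_of_off (w : Sym2 (Fin n) → unitInterval) (A B : Finset (Fin n)) (o b : Fin n) (j : ℕ)
    (h : (prodBernoulli fun e => if e ∈ {e : Sym2 (Fin n) | o ∉ e} then w e else 0).real
          {ω : BondConfig (Fin n) | (∀ x ∈ B, ω ∉ openConn b x) ∧
            1 ≤ (A.filter fun z => ∃ x ∈ B, ω ∈ openConn x z).card ∧
            (A.filter fun z => ∃ x ∈ B, ω ∈ openConn x z).card ≤ j} ≤
        (prodBernoulli fun e => if e ∈ {e : Sym2 (Fin n) | o ∉ e} then w e else 0).real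
          {ω : BondConfig (Fin n) | (∀ x ∈ B, ω ∉ openConn b x) ∧
            (A.filter fun z => ω ∈ openConn b z).card ≤ j}) :
    (prodBernoulli w).real {ω : BondConfig (Fin n) |
        (∀ y ∈ B, ¬ (openGraph (ω ∩ {e | o ∉ e})).Reachable b y) ∧
          1 ≤ (A.filter fun z => ∃ y ∈ B, (openGraph (ω ∩ {e | o ∉ e})).Reachable y z).card ∧
          (A.filter fun z => ∃ y ∈ B, (openGraph (ω ∩ {e | o ∉ e})).Reachable y z).card ≤ j} ≤
      (prodBernoulli w).real {ω : BondConfig (Fin n) |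
        (∀ y ∈ B, ¬ (openGraph (ω ∩ {e | o ∉ e})).Reachable b y) ∧
          (A.filter fun z => (openGraph (ω ∩ {e | o ∉ e})).Reachable b z).card ≤ j} := by
  set TL := {ξ : BondConfig (Fin n) | (∀ x ∈ B, ξ ∉ openConn b x) ∧
    1 ≤ (A.filter fun z => ∃ x ∈ B, ξ ∈ openConn x z).card ∧
    (A.filter fun z => ∃ x ∈ B, ξ ∈ openConn x z).card ≤ j} with hTL
  set TR := {ξ : BondConfig (Fin n) | (∀ x ∈ B, ξ ∉ openConn b x) ∧
    (A.filter fun z => ξ ∈ openConn b z).card ≤ j} with hTR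
  have eL : {ω : BondConfig (Fin n) |
        (∀ y ∈ B, ¬ (openGraph (ω ∩ {e | o ∉ e})).Reachable b y) ∧
          1 ≤ (A.filter fun z => ∃ y ∈ B, (openGraph (ω ∩ {e | o ∉ e})).Reachable y z).card ∧
          (A.filter fun z => ∃ y ∈ B, (openGraph (ω ∩ {e | o ∉ e})).Reachable y z).card ≤ j} =
      {ω : BondConfig (Fin n) | ω ∩ {e | o ∉ e} ∈ TL} := by
    ext ω; simp only [hTL, mem_setOf_eq, openConn]
  have eR : {ω : BondConfig (Fin n) |
        (∀ y ∈ B, ¬ (openGraph (ω ∩ {e | o ∉ e})).Reachable b y) ∧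
          (A.filter fun z => (openGraph (ω ∩ {e | o ∉ e})).Reachable b z).card ≤ j} =
      {ω : BondConfig (Fin n) | ω ∩ {e | o ∉ e} ∈ TR} := by
    ext ω; simp only [hTR, mem_setOf_eq, openConn]
  rw [eL, eR, CutObserver.measureReal_preimage_avoid, CutObserver.measureReal_preimage_avoid]
  exact h

end HullPort

end Summit.CriticalPhenomena.PercolationContinuityZ3.Theorems

end
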